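import Summits.QuantumFields.YangMills.Theorems.UnitScaleTiltProp7CombLadderCountExactWeights
import HarnessLib

/-!
# Route `UnitScaleTilt`, crux K1 «MinimiserStabilityRegPr» (stmt-QuantumFields-19200), route-R E′ path (α′), S3 K-form engine, row (H) — FILE 9h⁗ «OCC IDENTITY» (the count brick of
# record for the PARKED bridge hKg′-K(fam) ⟸ hKg-K, ★ym-ust-19200-p1 g16 NAMER WORD 11 (3) 2026-08-29 00:04Z): the PATH-OCCUPATION weight of a weighted family of lattice paths —
# `OCC(b) = Σ_m w_m·|p_m|·#{j : p_m[j] = b}` — has TOTAL `Σ_b OCC(b) = Σ_m w_m·|p_m|²` (exact) and SUP `OCC(b) ≤ Λ·Σ_m w_m·|p_m| ≤ Λ²·MASS` (`|p_m| ≤ Λ`; SHARP at a common root,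
# where every path passes: the located «root concentration», point-pinned Poincaré, d = 3), and the ℓ^∞ booking `Σ_m w_m·(Σ_(s∈p_m) x_s)² ≤ X²·Σ_m w_m·|p_m|²` for `|x| ≤ X`;
# plus the ℤ^d reading for the offset-comb transport paths `[ι]^h ++ Γ_(0,q)` (`|p| = h + ‖q‖₁ ≤ H + d·R`) against the exact weights of ✓ `Prop7CombLadderCountExact(Weights)`

Cell `ym3-torus`, width seat `ym3-torus-px9` (gen 4); my LOCATE «T2 PATH-OCCUPATION» (19200 evidence 739b943d492dc813: sup_b OCC ≈ 14·R⁶ by exact enumeration, not `C·R³·ℓ`) ⇒ NAMER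
WORD 11: cure (iv), no re-base to local kg; «px9 g4: OCC IDENTITY FILE GO» (low priority).  THEOREMS ONLY (0 `def`, 0 `sorry`); `--supports stmt-QuantumFields-19200 --as helper`,
count-neutral.  YM₃ on T³ is a RUNG of the ladder (R3) — not d = 4, not infinite volume, not a mass gap, not the Clay problem; nothing here claims a stub, the crux or any summit statement.

WHAT IS PROVED (ns `…Theorems.Prop7PathOccupation`; abstract: a finite family `S : Finset σ`, weights `w : σ → ℝ`, paths `p : σ → List β`; the occupation written INLINE as
`Σ_(m∈S) w m * (|p m| * (p m).count b)`).
* §1 ★★ `sum_occ_eq` (`Σ_(b∈B) OCC(b) = Σ_m w m·|p m|²` when every path lies in `B`), ★ `occ_le_mul_sum` (`OCC(b) ≤ Λ·Σ_m w m·|p m|`, `w ≥ 0`, `|p m| ≤ Λ`), `occ_le_sq_mul_mass`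
  (`≤ Λ²·Σ_m w m`), ★ `sum_mul_sq_sum_le_sup` (ℓ^∞ booking: `Σ_m w m·(Σ_(s∈p m) x s)² ≤ X²·Σ_m w m·|p m|²` for `|x s| ≤ X`, `w ≥ 0`), `sq_sum_le_length_sq_mul` (one path).
* §2 THE ℤ^d READING: `length_seg_append_treeWord_le`-type bound `h + ‖q‖₁ ≤ H + d·R` on the box written as `abs_sum_le` rows, and ★ `sum_offsets_weights_lengthSq_le` — per run `(D, κ)`:
  `Σ_(h<H) Σ_(q∈box) (W⁺_(D,κ)(q) + W⁻_(D,κ)(q))·(h + Σ_ν |q ν|)² ≤ H·(H + d·R)²·(C·R·(2R+1)^d)` (✓ `sum_box_weights_le`), i.e. the family's `Σ_m w_m|p_m|²` is `(H + dR)²`× its mass.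
HONEST SCOPE.  Finite bookkeeping; no estimate of any field; the bridge hKg′-K(fam) ⟸ hKg-K itself stays PARKED (NAMER WORD 11 (2)).

References: T. Bałaban, CMP 98 (1985) 17–51 [Balaban1985Averaging] ((19)–(20) p.21, p.24); CMP 102 (1985) 255–275 [Balaban1985UV3] ((27) p.263).
-/

set_option autoImplicit false

open scoped BigOperators

namespace Summit.QuantumFields.YangMills.Theorems.Prop7PathOccupation

open Literature.MathematicalPhysics.QuantumFieldTheory.Balaban1983to89
open B7Prop1Explicit (Site Letter e seg)
open Summit.QuantumFields.YangMills.Theorems.Prop7CombLadderCount (mem_box_iff)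
open Summit.QuantumFields.YangMills.Theorems.Prop7CombLadderCountExactWeights (sum_box_weights_le)

/-! ## §1 Abstract path occupation -/

section Abstract

variable {σ β : Type*} [DecidableEq β]

/-- ★★ **THE OCCUPATION IDENTITY**: if every path of the family lies in `B`, then `Σ_(b∈B) Σ_m w_m·|p_m|·#{j : p_m[j] = b} = Σ_m w_m·|p_m|²` — the occupation weight only
redistributes `w_m·|p_m|` over the `|p_m|` steps of each path. [cite: Balaban1985Averaging, (19)–(20) p.21, p.24] -/
theorem sum_occ_eq (S : Finset σ) (w : σ → ℝ) (p : σ → List β) (B : Finset β) (hB : ∀ m ∈ S, ∀ b ∈ p m, b ∈ B) :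
    ∑ b ∈ B, ∑ m ∈ S, w m * (((p m).length : ℝ) * ((p m).count b : ℝ)) = ∑ m ∈ S, w m * ((p m).length : ℝ) ^ 2 := by
  rw [Finset.sum_comm]
  refine Finset.sum_congr rfl fun m hm => ?_
  rw [← Finset.mul_sum, ← Finset.mul_sum, sq]
  congr 2
  have h := Multiset.sum_count_eq_card (s := B) (m := ((p m) : Multiset β)) (fun b hb => hB m hm b (Multiset.mem_coe.mp hb))
  simp only [Multiset.coe_count, Multiset.coe_card] at h
  exact_mod_cast h

/-- one path: `#{j : p[j] = b} ≤ |p|`. [folklore] -/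
theorem count_le_length_real (l : List β) (b : β) : ((l.count b : ℕ) : ℝ) ≤ (l.length : ℝ) := by
  exact_mod_cast List.count_le_length

/-- ★ **THE SUP BOUND**: for `w ≥ 0` and `|p_m| ≤ Λ` on the family, `OCC(b) = Σ_m w_m·|p_m|·#{j : p_m[j] = b} ≤ Λ·Σ_m w_m·|p_m|` at every `b` — SHARP when all paths share a root
(the located «root concentration»: every member passes the root's bonds). [cite: Balaban1985Averaging, p.24] -/
theorem occ_le_mul_sum (S : Finset σ) (w : σ → ℝ) (hw : ∀ m ∈ S, 0 ≤ w m) (p : σ → List β) (Λ : ℕ) (hΛ : ∀ m ∈ S, (p m).length ≤ Λ) (b : β) :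
    ∑ m ∈ S, w m * (((p m).length : ℝ) * ((p m).count b : ℝ)) ≤ (Λ : ℝ) * ∑ m ∈ S, w m * ((p m).length : ℝ) := by
  rw [Finset.mul_sum]
  refine Finset.sum_le_sum fun m hm => ?_
  have h1 : ((p m).count b : ℝ) ≤ (p m).length := count_le_length_real (p m) b
  have h2 : ((p m).length : ℝ) ≤ Λ := by exact_mod_cast hΛ m hm
  have h3 : (0 : ℝ) ≤ (p m).length := by positivity
  calc w m * (((p m).length : ℝ) * ((p m).count b : ℝ)) ≤ w m * (((p m).length : ℝ) * (p m).length) :=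
        mul_le_mul_of_nonneg_left (mul_le_mul_of_nonneg_left h1 h3) (hw m hm)
    _ ≤ w m * ((Λ : ℝ) * (p m).length) := mul_le_mul_of_nonneg_left (mul_le_mul_of_nonneg_right h2 h3) (hw m hm)
    _ = (Λ : ℝ) * (w m * ((p m).length : ℝ)) := by ring

/-- … and `≤ Λ²·MASS`. [cite: Balaban1985Averaging, p.24] -/
theorem occ_le_sq_mul_mass (S : Finset σ) (w : σ → ℝ) (hw : ∀ m ∈ S, 0 ≤ w m) (p : σ → List β) (Λ : ℕ) (hΛ : ∀ m ∈ S, (p m).length ≤ Λ) (b : β) :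
    ∑ m ∈ S, w m * (((p m).length : ℝ) * ((p m).count b : ℝ)) ≤ (Λ : ℝ) ^ 2 * ∑ m ∈ S, w m := by
  have h : ∑ m ∈ S, w m * ((p m).length : ℝ) ≤ (Λ : ℝ) * ∑ m ∈ S, w m := by
    rw [Finset.mul_sum]
    exact Finset.sum_le_sum fun m hm => by
      calc w m * ((p m).length : ℝ) ≤ w m * Λ := mul_le_mul_of_nonneg_left (by exact_mod_cast hΛ m hm) (hw m hm)
        _ = (Λ : ℝ) * w m := mul_comm _ _
  calc _ ≤ (Λ : ℝ) * ∑ m ∈ S, w m * ((p m).length : ℝ) := occ_le_mul_sum S w hw p Λ hΛ b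
    _ ≤ (Λ : ℝ) * ((Λ : ℝ) * ∑ m ∈ S, w m) := mul_le_mul_of_nonneg_left h (by positivity)
    _ = _ := by ring

end Abstract

section AbstractSup

variable {σ β : Type*}

/-- one path, ℓ^∞: `(Σ_(s∈p) x s)² ≤ |p|²·X²` for `|x s| ≤ X` along the path. [folklore] -/
theorem sq_sum_le_length_sq_mul (l : List β) (x : β → ℝ) (X : ℝ) (hx : ∀ s ∈ l, |x s| ≤ X) :
    ((l.map x).sum) ^ 2 ≤ ((l.length : ℝ) * X) ^ 2 := by
  have hX : ∀ s ∈ l, x s ≤ X ∧ -X ≤ x s := fun s hs => ⟨(le_abs_self _).trans (hx s hs), by have := hx s hs; have := neg_abs_le (x s); linarith⟩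
  have hub : (l.map x).sum ≤ (l.length : ℝ) * X := by
    have := List.sum_le_card_nsmul (l.map x) X (fun y hy => by obtain ⟨s, hs, rfl⟩ := List.mem_map.mp hy; exact (hX s hs).1)
    simpa [nsmul_eq_mul] using this
  have hlb : -((l.length : ℝ) * X) ≤ (l.map x).sum := by
    have := List.card_nsmul_le_sum (l.map x) (-X) (fun y hy => by obtain ⟨s, hs, rfl⟩ := List.mem_map.mp hy; exact (hX s hs).2)
    simpa [nsmul_eq_mul] using this
  exact sq_le_sq' hlb hub

/-- ★ **ℓ^∞ BOOKING**: for `w ≥ 0` and `|x s| ≤ X` along every path, `Σ_m w_m·(Σ_(s∈p_m) x s)² ≤ X²·Σ_m w_m·|p_m|²` — the transport-difference part booked with a SUP row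
(cure (i) of the LOCATE; the only booking the root concentration leaves intact). [cite: Balaban1985Averaging, (19)–(20) p.21] -/
theorem sum_mul_sq_sum_le_sup (S : Finset σ) (w : σ → ℝ) (hw : ∀ m ∈ S, 0 ≤ w m) (p : σ → List β) (x : β → ℝ) (X : ℝ)
    (hx : ∀ m ∈ S, ∀ s ∈ p m, |x s| ≤ X) :
    ∑ m ∈ S, w m * ((p m).map x).sum ^ 2 ≤ X ^ 2 * ∑ m ∈ S, w m * ((p m).length : ℝ) ^ 2 := by
  rw [Finset.mul_sum]
  refine Finset.sum_le_sum fun m hm => ?_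
  calc w m * ((p m).map x).sum ^ 2 ≤ w m * (((p m).length : ℝ) * X) ^ 2 := mul_le_mul_of_nonneg_left (sq_sum_le_length_sq_mul _ x X (hx m hm)) (hw m hm)
    _ = X ^ 2 * (w m * ((p m).length : ℝ) ^ 2) := by ring

end AbstractSup

/-! ## §2 The ℤ^d reading for the offset-comb transport paths -/

variable {d : ℕ}

/-- the ℓ¹ size of a box point: `Σ_ν |q ν| ≤ d·R` on `[−R,R]^d`. [folklore] -/
theorem sum_abs_le_of_mem_box (R : ℕ) (q : Site d) (hq : q ∈ Fintype.piFinset (fun _ : Fin d => Finset.Icc (-(R : ℤ)) (R : ℤ))) :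
    ∑ ν : Fin d, |(q ν : ℝ)| ≤ (d : ℝ) * R := by
  have hqb := (mem_box_iff (R := R)).mp hq
  calc ∑ ν : Fin d, |(q ν : ℝ)| ≤ ∑ _ν : Fin d, (R : ℝ) := Finset.sum_le_sum fun ν _ => by
          rw [← Int.cast_abs]; have := hqb ν; exact_mod_cast abs_le.mpr ⟨by omega, by omega⟩
    _ = (d : ℝ) * R := by rw [Finset.sum_const, Finset.card_univ, Fintype.card_fin, nsmul_eq_mul]

/-- the transport path `[ι]^h ++ Γ_(0,q)` has `|p|² = (h + ‖q‖₁)² ≤ (H + d·R)²` for `h < H`, `q ∈ [−R,R]^d`. [cite: Balaban1985UV3, (27) p.263] -/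
theorem lengthSq_le (R H : ℕ) (h : ℕ) (hh : h < H) (q : Site d) (hq : q ∈ Fintype.piFinset (fun _ : Fin d => Finset.Icc (-(R : ℤ)) (R : ℤ))) :
    ((h : ℝ) + ∑ ν : Fin d, |(q ν : ℝ)|) ^ 2 ≤ ((H : ℝ) + (d : ℝ) * R) ^ 2 := by
  have h1 : (h : ℝ) ≤ H := by exact_mod_cast hh.le
  have h2 := sum_abs_le_of_mem_box R q hq
  have h0 : 0 ≤ (h : ℝ) + ∑ ν : Fin d, |(q ν : ℝ)| := by positivity
  exact pow_le_pow_left₀ h0 (add_le_add h1 h2) 2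

/-- ★ **THE FAMILY'S `Σ_m w_m·|p_m|²` PER RUN**: for `c ≤ C` on the box, `0 ≤ c`, `0 ≤ C`,
`Σ_(h<H) Σ_(q∈box) (W⁺_(D,κ)(q) + W⁻_(D,κ)(q))·(h + Σ_ν|q ν|)² ≤ H·(H + d·R)²·(C·R·(2R+1)^d)` (✓ `sum_box_weights_le` times the path-length square). Divided by `H = ℓ′` this is the
`h`-averaged total occupation of the offset-comb transport paths of one run (`Σ_b OCC = ℓ′⁻¹Σ_hΣ W|w|²`, ✓ `sum_occ_eq`). [cite: Balaban1985Averaging, (19)–(20) p.21, p.24] -/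
theorem sum_offsets_weights_lengthSq_le (R H : ℕ) (D : Finset (Fin d)) (κ : Fin d) (hκ : κ ∉ D) (c : Site d → ℝ) (C : ℝ) (hC : 0 ≤ C)
    (hc0 : ∀ v ∈ Fintype.piFinset (fun _ : Fin d => Finset.Icc (-(R : ℤ)) (R : ℤ)), 0 ≤ c v)
    (hc : ∀ v ∈ Fintype.piFinset (fun _ : Fin d => Finset.Icc (-(R : ℤ)) (R : ℤ)), c v ≤ C) :
    ∑ h ∈ Finset.range H, ∑ q ∈ Fintype.piFinset (fun _ : Fin d => Finset.Icc (-(R : ℤ)) (R : ℤ)),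
        ((∑ v ∈ (Fintype.piFinset (fun _ : Fin d => Finset.Icc (-(R : ℤ)) (R : ℤ))).filter
              (fun v => (∀ ν ∈ D, q ν = v ν) ∧ (∀ ν, ν ∉ D → ν ≠ κ → q ν = 0) ∧ 0 ≤ q κ ∧ q κ < v κ), c v)
          + (∑ v ∈ (Fintype.piFinset (fun _ : Fin d => Finset.Icc (-(R : ℤ)) (R : ℤ))).filter
              (fun v => (∀ ν ∈ D, q ν = v ν) ∧ (∀ ν, ν ∉ D → ν ≠ κ → q ν = 0) ∧ v κ < q κ ∧ q κ ≤ 0), c v))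
          * ((h : ℝ) + ∑ ν : Fin d, |(q ν : ℝ)|) ^ 2
      ≤ (H : ℝ) * (((H : ℝ) + (d : ℝ) * R) ^ 2 * (C * R * (((2 * R + 1) ^ d : ℕ) : ℝ))) := by
  classical
  have hmass := sum_box_weights_le R D κ hκ c C hC hc
  have hWnn : ∀ q ∈ Fintype.piFinset (fun _ : Fin d => Finset.Icc (-(R : ℤ)) (R : ℤ)),
      0 ≤ (∑ v ∈ (Fintype.piFinset (fun _ : Fin d => Finset.Icc (-(R : ℤ)) (R : ℤ))).filter
              (fun v => (∀ ν ∈ D, q ν = v ν) ∧ (∀ ν, ν ∉ D → ν ≠ κ → q ν = 0) ∧ 0 ≤ q κ ∧ q κ < v κ), c v)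
          + (∑ v ∈ (Fintype.piFinset (fun _ : Fin d => Finset.Icc (-(R : ℤ)) (R : ℤ))).filter
              (fun v => (∀ ν ∈ D, q ν = v ν) ∧ (∀ ν, ν ∉ D → ν ≠ κ → q ν = 0) ∧ v κ < q κ ∧ q κ ≤ 0), c v) :=
    fun q _ => add_nonneg (Finset.sum_nonneg fun v hv => hc0 v (Finset.mem_filter.mp hv).1) (Finset.sum_nonneg fun v hv => hc0 v (Finset.mem_filter.mp hv).1)
  have hper : ∀ h ∈ Finset.range H, ∑ q ∈ Fintype.piFinset (fun _ : Fin d => Finset.Icc (-(R : ℤ)) (R : ℤ)),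
        ((∑ v ∈ (Fintype.piFinset (fun _ : Fin d => Finset.Icc (-(R : ℤ)) (R : ℤ))).filter
              (fun v => (∀ ν ∈ D, q ν = v ν) ∧ (∀ ν, ν ∉ D → ν ≠ κ → q ν = 0) ∧ 0 ≤ q κ ∧ q κ < v κ), c v)
          + (∑ v ∈ (Fintype.piFinset (fun _ : Fin d => Finset.Icc (-(R : ℤ)) (R : ℤ))).filter
              (fun v => (∀ ν ∈ D, q ν = v ν) ∧ (∀ ν, ν ∉ D → ν ≠ κ → q ν = 0) ∧ v κ < q κ ∧ q κ ≤ 0), c v))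
          * ((h : ℝ) + ∑ ν : Fin d, |(q ν : ℝ)|) ^ 2
      ≤ ((H : ℝ) + (d : ℝ) * R) ^ 2 * (C * R * (((2 * R + 1) ^ d : ℕ) : ℝ)) := by
    intro h hh
    calc _ ≤ ∑ q ∈ Fintype.piFinset (fun _ : Fin d => Finset.Icc (-(R : ℤ)) (R : ℤ)),
          ((∑ v ∈ (Fintype.piFinset (fun _ : Fin d => Finset.Icc (-(R : ℤ)) (R : ℤ))).filter
                (fun v => (∀ ν ∈ D, q ν = v ν) ∧ (∀ ν, ν ∉ D → ν ≠ κ → q ν = 0) ∧ 0 ≤ q κ ∧ q κ < v κ), c v)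
            + (∑ v ∈ (Fintype.piFinset (fun _ : Fin d => Finset.Icc (-(R : ℤ)) (R : ℤ))).filter
                (fun v => (∀ ν ∈ D, q ν = v ν) ∧ (∀ ν, ν ∉ D → ν ≠ κ → q ν = 0) ∧ v κ < q κ ∧ q κ ≤ 0), c v))
            * ((H : ℝ) + (d : ℝ) * R) ^ 2 :=
          Finset.sum_le_sum fun q hq => mul_le_mul_of_nonneg_left (lengthSq_le R H h (Finset.mem_range.mp hh) q hq) (hWnn q hq)
      _ ≤ _ := by rw [← Finset.sum_mul, mul_comm]; exact mul_le_mul_of_nonneg_left hmass (by positivity)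
  calc _ ≤ ∑ h ∈ Finset.range H, ((H : ℝ) + (d : ℝ) * R) ^ 2 * (C * R * (((2 * R + 1) ^ d : ℕ) : ℝ)) := Finset.sum_le_sum hper
    _ = _ := by rw [Finset.sum_const, Finset.card_range, nsmul_eq_mul]

end Summit.QuantumFields.YangMills.Theorems.Prop7PathOccupation
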